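import Literature.NumberTheory.LFunctions.EisensteinGrossencharacterSums
import Literature.NumberTheory.EllipticCurves.ComplexMultiplicationDeuring0Square
import HarnessLib

/-!
# Values of the Grössencharacter `ν_D = ν_{D,1,2}` of `ℚ(ζ₃)` at the primes, and the Frobenius traces
# of the `j = 0` curves

Helper file for the crux `PeterssonLowerBound` (stmt-ABC-10870), stub `stub_j0`: the arithmetic half of
`L(Sym² f_E, s) = L(s, χ₋₃) L(s, ν_E) E(s)` for the CM family `j = 0`, prime by prime, in terms of the
tree's Grössencharacters `grossenNu D r m` of `K3 = ℚ(ζ₃)` (`EisensteinGrossencharacterSums`) and of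
Deuring's `a_p² = χ_𝔭(Δ)ϖ² + conj + 2p` (`ComplexMultiplicationDeuring0Square`). Everything is proved:

* `psi_coe_asIdeal` — `ψ_D(𝔭) = e(χ_𝔭(D))` at a prime `𝔭 ∤ 3D` (both the Kummer case and the cube case);
* `cubicResidueSymbol_eq_of_mul_cube_eq` — `χ_𝔭(d) = χ_𝔭(Δ)` if `d c³ = Δ t³` with `c, t` units mod `𝔭`;
* `grossenNu_asIdeal_of_inert` — **`ν_{d,r,2}((p)) = 1`** for an inert `p ≡ 2 (mod 3)`, `p` odd, and a
  rational integer `d` prime to `p` (`χ_{(p)}(d) = 1` since `d^{p−1} ≡ 1`, and `((−p)/p)² = 1`);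
* `natCast_mul_grossenNu_asIdeal` — at a degree-one prime `𝔭 = (ϖ)`, `ϖ` primary, `N𝔭 = p`:
  `p · ν_D(𝔭) = e(χ_𝔭(D)) e(ϖ)²`, and `‖ν_D(𝔭)‖ = 1`;
* `frobeniusTrace_sq_eq_grossenNu` — for a globally minimal `W` with `j = 0`, `p ∤ 6Δ` and
  `χ_𝔭(D) = χ_𝔭(Δ_min)`: **`a_p(W)² = p ν_D(𝔭) + conj(p ν_D(𝔭)) + 2p`**;
* `grossenNu_mul_grossenNu_eq_one` — for the two primes `𝔭₁ ≠ 𝔭₂` above a split `p` with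
  `Re ν_D(𝔭₁) = Re ν_D(𝔭₂)`: **`ν_D(𝔭₁) ν_D(𝔭₂) = 1`** (the product is `ψ_D((p))`, a cube root of unity;
  were it `≠ 1`, `ν_D(𝔭₁)⁶ = 1` would force `ϖ₁¹² = p⁶`, i.e. `𝔭₁ = 𝔭₂`).

References: K. Ireland, M. Rosen, *A Classical Introduction to Modern Number Theory*, 2nd ed. (1990),
Ch. 9 §3, Ch. 18 §3–§7. [cite: IrelandRosen1990, Ch. 18 §3 Theorem 4]
-/

noncomputable section

set_option linter.dupNamespace false

open Complex NumberField IsDedekindDomain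
open scoped ComplexConjugate
open Literature.NumberTheory.LFunctions.EisensteinGrossen Literature.NumberTheory.NumberFields
  Literature.NumberTheory.NumberFields.K3 Literature.NumberTheory.GaloisRepresentations
  Literature.NumberTheory.LFunctions.PlaneLattice

namespace Summit.ABC.ABC.Theorems.PeterssonJ0

/-! ### Coprimality at a prime of `𝓞 K3` -/

/-- A maximal ideal is coprime to `(x)` for `x` outside it. [folklore] -/
theorem isCoprime_span_singleton_of_not_mem {R : Type*} [CommRing R] {M : Ideal R} (hM : M.IsMaximal)
    {x : R} (hx : x ∉ M) : IsCoprime M (Ideal.span {x}) := by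
  obtain ⟨y, i, hi, h⟩ := hM.exists_inv hx
  exact Ideal.isCoprime_iff_exists.mpr ⟨i, hi, y * x, Ideal.mem_span_singleton'.mpr ⟨y, rfl⟩, by
    rw [add_comm]; exact h⟩

/-- `𝔭` is admissible for `ν_D` (`𝔭 ≠ 0`, `𝔭 + (3D) = (1)`) as soon as `3 ∉ 𝔭` and `D ∉ 𝔭`. [folklore] -/
theorem adm_asIdeal {D : 𝓞 K3} (v : HeightOneSpectrum (𝓞 K3)) (h3v : (3 : 𝓞 K3) ∉ v.asIdeal)
    (hDv : D ∉ v.asIdeal) : Adm D v.asIdeal := by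
  refine ⟨v.ne_bot, isCoprime_span_singleton_of_not_mem v.isMaximal fun h ↦ ?_⟩
  rcases v.isPrime.mem_or_mem h with h | h
  · exact h3v h
  · exact hDv h

/-- `𝔭` prime to `3` in the sense of `primGen`. [folklore] -/
theorem isCoprime_three_asIdeal (v : HeightOneSpectrum (𝓞 K3)) (h3v : (3 : 𝓞 K3) ∉ v.asIdeal) :
    IsCoprime v.asIdeal three :=
  isCoprime_span_singleton_of_not_mem v.isMaximal h3v

/-- A rational integer `d` prime to the rational prime `p ∈ 𝔭` is not in `𝔭`. [folklore] -/
theorem intCast_not_mem_of_isCoprime {p d : ℤ} (v : HeightOneSpectrum (𝓞 K3)) (hpv : (p : 𝓞 K3) ∈ v.asIdeal)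
    (hpd : IsCoprime p d) : (d : 𝓞 K3) ∉ v.asIdeal := by
  intro hd
  obtain ⟨a, b, hab⟩ := hpd
  have h1 : (1 : 𝓞 K3) ∈ v.asIdeal := by
    have e : (1 : 𝓞 K3) = (a : 𝓞 K3) * p + (b : 𝓞 K3) * d := by
      have h := congrArg (Int.cast (R := 𝓞 K3)) hab
      simp only [Int.cast_add, Int.cast_mul, Int.cast_one] at h
      exact h.symm
    rw [e]
    exact v.asIdeal.add_mem (v.asIdeal.mul_mem_left _ hpv) (v.asIdeal.mul_mem_left _ hd)
  exact v.isPrime.ne_top ((Ideal.eq_top_iff_one _).mpr h1)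

/-! ### `ψ_D` at a prime is the cubic residue symbol -/

/-- **`ψ_D(𝔭) = e(χ_𝔭(D))` for `𝔭 ∤ 3D`** (the Artin symbol of the Kummer character at a Frobenius,
`artinSymbol_kummerChar_asIdeal`; in the excluded case `D = b³` both sides are `1`).
[cite: IrelandRosen1990, Ch. 9 §3 Prop. 9.3.3] -/
theorem psi_coe_asIdeal (D : 𝓞 K3) (v : HeightOneSpectrum (𝓞 K3)) (hDv : D ∉ v.asIdeal)
    (h3v : (3 : 𝓞 K3) ∉ v.asIdeal) :
    ((psi D v.asIdeal : ℂˣ) : ℂ) =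
      embC ((cubicResidueSymbol v (Ideal.Quotient.mk v.asIdeal D) : 𝓞 K3) : K3) := by
  unfold psi psiLoc
  split_ifs with hD
  · haveI := isGalois_kummerField hζ hD
    exact artinSymbol_kummerChar_asIdeal hζ hD embC.toRingHom v hDv h3v
  · push Not at hD
    obtain ⟨b, hb⟩ := hD
    rw [artinSymbol_const_one, cubicResidueSymbol_eq_one_of_cube hζ hb v hDv h3v]
    simp

/-- `e(χ_𝔭(a))³ = 1` and `‖e(χ_𝔭(a))‖ = 1` for `a ≢ 0`, `𝔭 ∤ 3`. [folklore] -/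
theorem embC_cubicResidueSymbol_pow_three (v : HeightOneSpectrum (𝓞 K3)) (h3v : (3 : 𝓞 K3) ∉ v.asIdeal)
    {a : 𝓞 K3 ⧸ v.asIdeal} (ha : a ≠ 0) :
    embC ((cubicResidueSymbol v a : 𝓞 K3) : K3) ^ 3 = 1 ∧ ‖embC ((cubicResidueSymbol v a : 𝓞 K3) : K3)‖ = 1 := by
  have h3 : embC ((cubicResidueSymbol v a : 𝓞 K3) : K3) ^ 3 = 1 := by
    rw [← map_pow, RingOfIntegers.coe_eq_algebraMap, ← map_pow, (cubicResidueSymbol_spec hζ h3v ha).1,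
      map_one, map_one]
  exact ⟨h3, Complex.norm_eq_one_of_pow_eq_one h3 (by norm_num)⟩

/-- `χ_𝔭(x)³ = 1` for `x ∉ 𝔭`, `𝔭 ∤ 3`. [folklore] -/
theorem cubicResidueSymbol_pow_three_eq_one (v : HeightOneSpectrum (𝓞 K3)) (h3v : (3 : 𝓞 K3) ∉ v.asIdeal)
    {x : 𝓞 K3} (hx : x ∉ v.asIdeal) : cubicResidueSymbol v (Ideal.Quotient.mk v.asIdeal x) ^ 3 = 1 :=
  (cubicResidueSymbol_spec hζ h3v (fun h ↦ hx (Ideal.Quotient.eq_zero_iff_mem.mp h))).1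

/-- **Cubic characters ignore cubes of units**: if `d c³ = Δ t³` in `ℤ` with `c, t` prime to the rational
prime `p ∈ 𝔭`, `𝔭 ∤ 3`, then `χ_𝔭(d) = χ_𝔭(Δ)`. [folklore] -/
theorem cubicResidueSymbol_eq_of_mul_cube_eq {p d Δ c t : ℤ} (v : HeightOneSpectrum (𝓞 K3))
    (hpv : (p : 𝓞 K3) ∈ v.asIdeal) (h3v : (3 : 𝓞 K3) ∉ v.asIdeal) (hc : IsCoprime p c) (ht : IsCoprime p t)
    (h : d * c ^ 3 = Δ * t ^ 3) :
    cubicResidueSymbol v (Ideal.Quotient.mk v.asIdeal (d : 𝓞 K3)) =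
      cubicResidueSymbol v (Ideal.Quotient.mk v.asIdeal (Δ : 𝓞 K3)) := by
  have hcv := intCast_not_mem_of_isCoprime v hpv hc
  have htv := intCast_not_mem_of_isCoprime v hpv ht
  have key := congrArg (fun z : ℤ ↦ Ideal.Quotient.mk v.asIdeal (z : 𝓞 K3)) h
  simp only [Int.cast_mul, Int.cast_pow, map_mul, map_pow] at key
  have hχ := congrArg (cubicResidueChar hζ v h3v) key
  rw [map_mul, map_mul, map_pow, map_pow, cubicResidueChar_apply, cubicResidueChar_apply,
    cubicResidueChar_apply, cubicResidueChar_apply, cubicResidueSymbol_pow_three_eq_one v h3v hcv,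
    cubicResidueSymbol_pow_three_eq_one v h3v htv, mul_one, mul_one] at hχ
  exact hχ

/-! ### The inert primes: `ν_{d,r,2}((p)) = 1` -/

/-- For `p ≡ 2 (mod 3)`: `(p² − 1)/3 = (p − 1) · ((p + 1)/3)`. [folklore] -/
theorem sq_sub_one_div_three {p : ℕ} (hp3 : p % 3 = 2) : (p ^ 2 - 1) / 3 = (p - 1) * ((p + 1) / 3) := by
  obtain ⟨t, ht⟩ : 3 ∣ p + 1 := by omega
  have ht' : (p + 1) / 3 = t := by omega
  rw [ht']
  have hp1 : 1 ≤ p := by omega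
  have h : p ^ 2 - 1 = 3 * ((p - 1) * t) := by
    zify [hp1, Nat.one_le_pow 2 p (by omega)]
    have ht2 : ((p : ℤ) + 1) = 3 * t := by exact_mod_cast ht
    linear_combination ((p : ℤ) - 1) * ht2
  rw [h, Nat.mul_div_cancel_left _ (by norm_num)]

/-- **`χ_{(p)}(d) = 1`** for an odd inert prime `p ≡ 2 (mod 3)` and a rational integer `d` prime to `p`:
`d^{(p²−1)/3} = (d^{p−1})^{(p+1)/3} ≡ 1`. [cite: IrelandRosen1990, Ch. 9 §3 (remark after Prop. 9.3.3)] -/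
theorem cubicResidueSymbol_intCast_eq_one_of_inert {p : ℕ} (hp : p.Prime) (hp3 : p % 3 = 2) (hp2 : p ≠ 2)
    (v : HeightOneSpectrum (𝓞 K3)) (hv : v.asIdeal = Ideal.span {(p : 𝓞 K3)}) {d : ℤ} (hpd : ¬ (p : ℤ) ∣ d) :
    cubicResidueSymbol v (Ideal.Quotient.mk v.asIdeal (d : 𝓞 K3)) = 1 := by
  haveI : Fact p.Prime := ⟨hp⟩
  have hpv : (p : 𝓞 K3) ∈ v.asIdeal := by rw [hv]; exact Ideal.mem_span_singleton_self _
  have h3v : (3 : 𝓞 K3) ∉ v.asIdeal :=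
    three_not_mem_of_natCast_mem hpv (by rw [Nat.coprime_comm, Nat.Prime.coprime_iff_not_dvd Nat.prime_three]; omega)
  -- `N𝔭 = p²`
  have hcard : v.residueCard = p ^ 2 := by
    rw [HeightOneSpectrum.residueCard, hv, Literature.NumberTheory.LFunctions.IdealNormCount.absNorm_span_natCast,
      finrank_eq]
  refine cubicResidueSymbol_eq_of_pow_three_eq_one hζ h3v (one_pow 3) ?_
  rw [map_one, hcard, sq_sub_one_div_three hp3, pow_mul, map_intCast]
  -- `d^{p-1} = 1` in the residue field
  have hodd : p % 2 = 1 := (hp.eq_two_or_odd).resolve_left hp2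
  have heven : Even (p - 1) := ⟨(p - 1) / 2, by omega⟩
  have hn : ¬ p ∣ d.natAbs := fun h ↦ hpd (Int.natCast_dvd.mpr h)
  have hnat : ((d.natAbs : 𝓞 K3 ⧸ v.asIdeal)) ^ (p - 1) = 1 := natCast_pow_sub_one_eq_one hpv hn
  have hd : (d : 𝓞 K3 ⧸ v.asIdeal) ^ (p - 1) = 1 := by
    rcases Int.natAbs_eq d with h | h
    · rw [h, Int.cast_natCast, hnat]
    · rw [h, Int.cast_neg, Int.cast_natCast, neg_pow, hnat, heven.neg_one_pow, one_mul]
  rw [hd, one_pow]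

/-- **`ν_{d,r,2}((p)) = 1` at an odd inert prime `p ∤ d`** (`ψ_d((p)) = 1`, primary generator `−p`,
`((−p)/p)² = 1`). [cite: IrelandRosen1990, Ch. 18 §7] -/
theorem grossenNu_asIdeal_of_inert {p : ℕ} (hp : p.Prime) (hp3 : p % 3 = 2) (hp2 : p ≠ 2)
    (v : HeightOneSpectrum (𝓞 K3)) (hv : v.asIdeal = Ideal.span {(p : 𝓞 K3)}) {d : ℤ}
    (hpd : ¬ (p : ℤ) ∣ d) (r : ℕ) : grossenNu (d : 𝓞 K3) r 2 v.asIdeal = 1 := by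
  have hpv : (p : 𝓞 K3) ∈ v.asIdeal := by rw [hv]; exact Ideal.mem_span_singleton_self _
  have h3v : (3 : 𝓞 K3) ∉ v.asIdeal :=
    three_not_mem_of_natCast_mem hpv (by rw [Nat.coprime_comm, Nat.Prime.coprime_iff_not_dvd Nat.prime_three]; omega)
  have hdv : ((d : ℤ) : 𝓞 K3) ∉ v.asIdeal :=
    intCast_not_mem_of_isCoprime v (by rw [Int.cast_natCast]; exact hpv)
      ((Nat.prime_iff_prime_int.mp hp).irreducible.coprime_iff_not_dvd.mpr hpd)
  have hadm : Adm (d : 𝓞 K3) v.asIdeal := adm_asIdeal v h3v hdv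
  -- primary generator `-p`
  have hgen : primGen v.asIdeal = -(p : 𝓞 K3) := by
    refine primGen_eq_of hadm.coprime_three ?_ ?_
    · rw [Ideal.span_singleton_neg, hv]
    · obtain ⟨t, ht⟩ : 3 ∣ p + 1 := by omega
      refine Ideal.mem_span_singleton'.mpr ⟨-(t : 𝓞 K3), ?_⟩
      have h : ((p : ℕ) : 𝓞 K3) + 1 = 3 * (t : 𝓞 K3) := by
        have h := congrArg (Nat.cast (R := 𝓞 K3)) ht
        simp only [Nat.cast_add, Nat.cast_mul, Nat.cast_one, Nat.cast_ofNat] at h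
        exact h
      linear_combination h
  rw [grossenNu_apply, if_pos hadm, psi_coe_asIdeal _ v hdv h3v,
    cubicResidueSymbol_intCast_eq_one_of_inert hp hp3 hp2 v hv hpd, hgen]
  have hp0 : (p : ℂ) ≠ 0 := by exact_mod_cast hp.ne_zero
  have he : embC ((-(p : 𝓞 K3) : 𝓞 K3) : K3) = -(p : ℂ) := by simp
  simp only [map_one, one_pow, one_mul, sectorWeight, he, norm_neg,
    Complex.norm_natCast, Complex.ofReal_natCast]
  rw [neg_div, div_self hp0]; norm_num

/-! ### The split primes: `p ν_D(𝔭) = e(χ_𝔭(D)) e(ϖ)²` -/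

section Split

variable {D : 𝓞 K3} {p : ℕ}

/-- `‖e(ϖ_𝔭)‖² = N𝔭` for the primary generator of a prime `𝔭 ∤ 3`. [folklore] -/
theorem norm_embC_primGen_sq (v : HeightOneSpectrum (𝓞 K3)) (h3v : (3 : 𝓞 K3) ∉ v.asIdeal) :
    ‖embC (primGen v.asIdeal : K3)‖ ^ 2 = (Ideal.absNorm v.asIdeal : ℝ) := by
  rw [← absNorm_span_singleton_eq, span_primGen (isCoprime_three_asIdeal v h3v)]

/-- **`p · ν_{D,1,2}(𝔭) = e(χ_𝔭(D)) · e(ϖ_𝔭)²`** and **`‖ν_{D,1,2}(𝔭)‖ = 1`** at a prime `𝔭 ∤ 3D` of norm `p`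
with primary generator `ϖ_𝔭`. [cite: IrelandRosen1990, Ch. 18 §7] -/
theorem natCast_mul_grossenNu_asIdeal (v : HeightOneSpectrum (𝓞 K3)) (h3v : (3 : 𝓞 K3) ∉ v.asIdeal)
    (hDv : D ∉ v.asIdeal) (hNv : Ideal.absNorm v.asIdeal = p) (hp : p ≠ 0) :
    (p : ℂ) * grossenNu D 1 2 v.asIdeal =
        embC ((cubicResidueSymbol v (Ideal.Quotient.mk v.asIdeal D) : 𝓞 K3) : K3) *
          embC (primGen v.asIdeal : K3) ^ 2 ∧
      ‖grossenNu D 1 2 v.asIdeal‖ = 1 := by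
  have hadm : Adm D v.asIdeal := adm_asIdeal v h3v hDv
  have hz2 : ‖embC (primGen v.asIdeal : K3)‖ ^ 2 = p := by rw [norm_embC_primGen_sq v h3v, hNv]
  have hp0 : (p : ℝ) ≠ 0 := by exact_mod_cast hp
  have hz0 : ‖embC (primGen v.asIdeal : K3)‖ ≠ 0 := by
    intro h; rw [h] at hz2; norm_num at hz2; exact hp (by exact_mod_cast hz2.symm)
  have hD0 : Ideal.Quotient.mk v.asIdeal D ≠ 0 := fun h ↦ hDv (Ideal.Quotient.eq_zero_iff_mem.mp h)
  obtain ⟨-, hε⟩ := embC_cubicResidueSymbol_pow_three v h3v hD0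
  rw [grossenNu_apply, if_pos hadm, psi_coe_asIdeal _ v hDv h3v, pow_one]
  set z : ℂ := embC (primGen v.asIdeal : K3) with hz
  have hsw : sectorWeight 2 z = z ^ 2 / p := by
    simp only [sectorWeight, div_pow, ← Complex.ofReal_pow, hz2, Complex.ofReal_natCast]
  constructor
  · rw [hsw]
    have hpC : (p : ℂ) ≠ 0 := by exact_mod_cast hp
    field_simp
  · rw [norm_mul, hε, one_mul, hsw, norm_div, norm_pow, hz2, Complex.norm_natCast, div_self hp0]

/-- **Deuring for the square, in terms of `ν`**: for a globally minimal `W/ℚ` with `j(W) = 0`, a prime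
`p ∤ 6Δ_min`, a prime `𝔭 ∋ p` of `K3` of norm `p` with `𝔭 ∤ D` and `χ_𝔭(D) = χ_𝔭(Δ_min)`:
`a_p(W)² = p ν_D(𝔭) + conj(p ν_D(𝔭)) + 2p`. [cite: IrelandRosen1990, Ch. 18 §3 Theorem 4] -/
theorem frobeniusTrace_sq_eq_grossenNu (W : WeierstrassCurve ℚ) [W.IsElliptic] [W.IsGloballyMinimal]
    (hj : W.j = 0) (hp : p.Prime) (h2 : p ≠ 2) (h3 : p ≠ 3) (hΔ : ¬ (p : ℤ) ∣ W.minimalDiscriminantInt)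
    (v : HeightOneSpectrum (𝓞 K3)) (hpv : (p : 𝓞 K3) ∈ v.asIdeal) (hNv : Ideal.absNorm v.asIdeal = p)
    (hDv : D ∉ v.asIdeal)
    (hχ : cubicResidueSymbol v (Ideal.Quotient.mk v.asIdeal D) =
      cubicResidueSymbol v (Ideal.Quotient.mk v.asIdeal (W.minimalDiscriminantInt : 𝓞 K3))) :
    ((W.frobeniusTrace p : ℤ) : ℂ) ^ 2 =
      p * grossenNu D 1 2 v.asIdeal + conj ((p : ℂ) * grossenNu D 1 2 v.asIdeal) + 2 * p := by
  have h3v : (3 : 𝓞 K3) ∉ v.asIdeal :=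
    three_not_mem_of_natCast_mem hpv ((Nat.coprime_primes hp Nat.prime_three).mpr h3)
  obtain ⟨hval, -⟩ := natCast_mul_grossenNu_asIdeal v h3v hDv hNv hp.ne_zero
  have hcop := isCoprime_three_asIdeal v h3v
  have h := Literature.NumberTheory.EllipticCurves.frobeniusTrace_sq_of_j_eq_zero hζ W hj hp h2 h3 hΔ
    embC.toRingHom hpv hNv (span_primGen hcop) (primGen_sub_one_mem hcop)
  rw [h, hval, hχ]
  rfl

/-! ### The two primes above a split `p`: `ν_D(𝔭₁) ν_D(𝔭₂) = 1` -/

/-- Two complex numbers of modulus `1` with the same real part are equal or conjugate. [folklore] -/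
theorem eq_or_eq_conj_of_norm_eq_one {u w : ℂ} (hu : ‖u‖ = 1) (hw : ‖w‖ = 1)
    (hre : u + conj u = w + conj w) : w = u ∨ w = conj u := by
  have hr : w.re = u.re := by
    have h := congrArg Complex.re hre
    simp only [Complex.add_re, Complex.conj_re] at h
    linarith
  have hu2 : u.re * u.re + u.im * u.im = 1 := by
    have := Complex.normSq_eq_norm_sq u; rw [hu, Complex.normSq_apply] at this; linarith
  have hw2 : w.re * w.re + w.im * w.im = 1 := by
    have := Complex.normSq_eq_norm_sq w; rw [hw, Complex.normSq_apply] at this; linarith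
  have him : w.im * w.im = u.im * u.im := by rw [hr] at hw2; linarith
  rcases mul_self_eq_mul_self_iff.mp him with h | h
  · exact Or.inl (Complex.ext hr h)
  · exact Or.inr (Complex.ext (by rw [Complex.conj_re]; exact hr) (by rw [Complex.conj_im]; exact h))

/-- `ν_{D,1,2}((p)) = ψ_D((p))` for a split `p ≡ 1 (mod 3)` prime to `3D` (primary generator `p`,
`(p/p)² = 1`), and `ψ_D((p))³ = 1`. [folklore] -/
theorem grossenNu_span_natCast_of_split (hp : p.Prime) (hp1 : p % 3 = 1)
    (hadm : Adm D (Ideal.span {(p : 𝓞 K3)})) :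
    grossenNu D 1 2 (Ideal.span {(p : 𝓞 K3)}) = ((psi D (Ideal.span {(p : 𝓞 K3)}) : ℂˣ) : ℂ) ∧
      grossenNu D 1 2 (Ideal.span {(p : 𝓞 K3)}) ^ 3 = 1 := by
  have h1 : (p : 𝓞 K3) - 1 ∈ three := by
    obtain ⟨t, ht⟩ : 3 ∣ p - 1 := by omega
    refine Ideal.mem_span_singleton'.mpr ⟨(t : 𝓞 K3), ?_⟩
    have hp1' : 1 ≤ p := hp.one_lt.le
    have h : ((p : ℕ) : 𝓞 K3) - 1 = 3 * (t : 𝓞 K3) := by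
      have h := congrArg (Nat.cast (R := 𝓞 K3)) ht
      simp only [Nat.cast_sub hp1', Nat.cast_mul, Nat.cast_one, Nat.cast_ofNat] at h
      exact h
    rw [h]; ring
  have hval : grossenNu D 1 2 (Ideal.span {(p : 𝓞 K3)}) = ((psi D (Ideal.span {(p : 𝓞 K3)}) : ℂˣ) : ℂ) := by
    rw [grossenNu_span_of_primary _ _ _ h1 hadm, pow_one]
    have hp0 : (p : ℂ) ≠ 0 := by exact_mod_cast hp.ne_zero
    have he : embC (((p : 𝓞 K3) : 𝓞 K3) : K3) = (p : ℂ) := by simp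
    simp only [sectorWeight, he, Complex.norm_natCast, Complex.ofReal_natCast, div_self hp0, one_pow, mul_one]
  refine ⟨hval, ?_⟩
  rw [hval, ← Units.val_pow_eq_pow_val, psi_pow_three, Units.val_one]

/-- `ϖ_𝔭¹² ≠ p⁶` for a prime `𝔭` with `(p) = 𝔭 𝔭'`, `𝔭 ≠ 𝔭'` (unique factorisation). [folklore] -/
theorem embC_primGen_pow_twelve_ne (v₁ v₂ : HeightOneSpectrum (𝓞 K3))
    (hne : v₁.asIdeal ≠ v₂.asIdeal) (hprod : v₁.asIdeal * v₂.asIdeal = Ideal.span {(p : 𝓞 K3)})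
    (h3v₁ : (3 : 𝓞 K3) ∉ v₁.asIdeal) :
    embC (primGen v₁.asIdeal : K3) ^ 12 ≠ (p : ℂ) ^ 6 := by
  intro h
  have hcop := isCoprime_three_asIdeal v₁ h3v₁
  set ϖ := primGen v₁.asIdeal with hϖ
  -- `ϖ¹² = p⁶` in `𝓞 K3`
  have hK : ((ϖ ^ 12 : 𝓞 K3) : K3) = (((p : 𝓞 K3) ^ 6 : 𝓞 K3) : K3) := by
    apply embC_injective
    push_cast
    rw [map_pow, h]; simp
  have hO : ϖ ^ 12 = (p : 𝓞 K3) ^ 6 := RingOfIntegers.coe_injective hK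
  -- ideals: `𝔭₁¹² = (𝔭₁𝔭₂)⁶`
  have hI : v₁.asIdeal ^ 12 = (v₁.asIdeal * v₂.asIdeal) ^ 6 := by
    rw [hprod, Ideal.span_singleton_pow, ← hO, ← Ideal.span_singleton_pow, span_primGen hcop]
  rw [mul_pow, show (12 : ℕ) = 6 + 6 by norm_num, pow_add] at hI
  have h6 : v₁.asIdeal ^ 6 = v₂.asIdeal ^ 6 := mul_left_cancel₀ (pow_ne_zero 6 v₁.ne_bot) hI
  have hdvd : v₂.asIdeal ∣ v₁.asIdeal ^ 6 := ⟨v₂.asIdeal ^ 5, by rw [h6, ← pow_succ']⟩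
  have hdvd' : v₂.asIdeal ∣ v₁.asIdeal := (Ideal.prime_of_isPrime v₂.ne_bot v₂.isPrime).dvd_of_dvd_pow hdvd
  exact hne (v₁.isMaximal.eq_of_le v₂.isPrime.ne_top (Ideal.dvd_iff_le.mp hdvd'))

/-- **`ν_D(𝔭₁) ν_D(𝔭₂) = 1`** for the two primes above a split `p ≡ 1 (mod 3)`, `p ∤ 3D`, as soon as
`ν_D(𝔭₁)` and `ν_D(𝔭₂)` have the same real part (which Deuring's formula provides): the product is
`ν_D((p)) = ψ_D((p))`, a cube root of unity; if `ν_D(𝔭₂) = conj ν_D(𝔭₁)` we are done, and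
`ν_D(𝔭₂) = ν_D(𝔭₁)` would give `ν_D(𝔭₁)⁶ = 1`, i.e. `ϖ₁¹² = p⁶`, impossible.
[cite: IrelandRosen1990, Ch. 18 §7] -/
theorem grossenNu_mul_grossenNu_eq_one (hp : p.Prime) (hp1 : p % 3 = 1) (v₁ v₂ : HeightOneSpectrum (𝓞 K3))
    (hne : v₁.asIdeal ≠ v₂.asIdeal) (hprod : v₁.asIdeal * v₂.asIdeal = Ideal.span {(p : 𝓞 K3)})
    (h3v₁ : (3 : 𝓞 K3) ∉ v₁.asIdeal) (h3v₂ : (3 : 𝓞 K3) ∉ v₂.asIdeal) (hDv₁ : D ∉ v₁.asIdeal)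
    (hDv₂ : D ∉ v₂.asIdeal) (hN₁ : Ideal.absNorm v₁.asIdeal = p) (hN₂ : Ideal.absNorm v₂.asIdeal = p)
    (hre : grossenNu D 1 2 v₁.asIdeal + conj (grossenNu D 1 2 v₁.asIdeal) =
      grossenNu D 1 2 v₂.asIdeal + conj (grossenNu D 1 2 v₂.asIdeal)) :
    grossenNu D 1 2 v₁.asIdeal * grossenNu D 1 2 v₂.asIdeal = 1 := by
  obtain ⟨hval₁, hu1⟩ := natCast_mul_grossenNu_asIdeal v₁ h3v₁ hDv₁ hN₁ hp.ne_zero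
  obtain ⟨-, hw1⟩ := natCast_mul_grossenNu_asIdeal v₂ h3v₂ hDv₂ hN₂ hp.ne_zero
  -- the product is a cube root of unity
  have hadm : Adm D (Ideal.span {(p : 𝓞 K3)}) := by
    rw [← hprod]; exact (adm_mul_iff D).mpr ⟨adm_asIdeal v₁ h3v₁ hDv₁, adm_asIdeal v₂ h3v₂ hDv₂⟩
  have hcube : (grossenNu D 1 2 v₁.asIdeal * grossenNu D 1 2 v₂.asIdeal) ^ 3 = 1 := by
    rw [← map_mul, hprod]
    exact (grossenNu_span_natCast_of_split hp hp1 hadm).2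
  rcases eq_or_eq_conj_of_norm_eq_one hu1 hw1 hre with h | h
  · -- `ν(𝔭₂) = ν(𝔭₁)`: then `ν(𝔭₁)⁶ = 1`, i.e. `ϖ₁¹² = p⁶`
    exfalso
    rw [h] at hcube
    have hu6 : grossenNu D 1 2 v₁.asIdeal ^ 6 = 1 := by
      rw [show (6 : ℕ) = 2 * 3 by norm_num, pow_mul, sq]; exact hcube
    have hD0 : Ideal.Quotient.mk v₁.asIdeal D ≠ 0 := fun h0 ↦ hDv₁ (Ideal.Quotient.eq_zero_iff_mem.mp h0)
    obtain ⟨hε3, -⟩ := embC_cubicResidueSymbol_pow_three v₁ h3v₁ hD0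
    apply embC_primGen_pow_twelve_ne v₁ v₂ hne hprod h3v₁
    have key : ((p : ℂ) * grossenNu D 1 2 v₁.asIdeal) ^ 6 = (p : ℂ) ^ 6 := by rw [mul_pow, hu6, mul_one]
    rw [hval₁, mul_pow, show (6 : ℕ) = 3 * 2 by norm_num, pow_mul, hε3, one_pow, one_mul, ← pow_mul] at key
    norm_num at key
    exact key
  · rw [h, Complex.mul_conj, Complex.normSq_eq_norm_sq, hu1]; norm_num

end Split

end Summit.ABC.ABC.Theorems.PeterssonJ0

namespace Summit.ABC.ABC.Theorems

/-- **Registered sub-goal `stub_j0_values` of stub `stub_j0`** (crux stmt-ABC-10870): two unimodular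
complex numbers with the same real part are equal or conjugate (the dichotomy behind
`ν_D(𝔭₁) ν_D(𝔭₂) = 1`). [folklore] -/
theorem stub_j0_values : ∀ u w : ℂ, ‖u‖ = 1 → ‖w‖ = 1 → u + starRingEnd ℂ u = w + starRingEnd ℂ w → w = u ∨ w = starRingEnd ℂ u :=
  fun _ _ hu hw hre ↦ PeterssonJ0.eq_or_eq_conj_of_norm_eq_one hu hw hre

end Summit.ABC.ABC.Theorems

end
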